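import Summits.FinalStateConjecture.FinalStateConjecture.Theorems.EIHFluxBalanceInertialRecessionStubIdentificationSphereCompare
import Summits.FinalStateConjecture.FinalStateConjecture.Theorems.EIHFluxBalanceInertialRecessionStubIdentificationKerrCharge
import Summits.FinalStateConjecture.FinalStateConjecture.Theorems.EIHFluxBalanceInertialRecessionStubIdentificationBulk
import Summits.FinalStateConjecture.FinalStateConjecture.Theorems.EIHFluxBalanceInertialRecessionStubIdentificationRates
import Summits.FinalStateConjecture.FinalStateConjecture.Theorems.EIHFluxBalanceInertialRecessionStubChargeModelSpheres

/-!
# Route EIHFluxBalance — `InertialRecession`, line `sublinear-is-free-clean-window-charges`: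
# bookkeeping lemmas of the identification assembly (stub `stub_identification`, part A5c-2)

Helper file (`--supports stmt-FinalStateConjecture-10166`) for the crux
`Summit.FinalStateConjecture.FinalStateConjecture.Theses.EIHFluxBalance.InertialRecession`.

Small inputs of the assembly of `stub_identification`: the weighted decay clause in function form,
the pairwise separation function, the weight exponent identities, the cone bound of window balls, the
monotonicity of the defect bound, and the continuity of the momentum density of a frozen boosted Kerr
field on lab spheres. [cite: LandauLifshitz1975, §96]
-/

set_option linter.dupNamespace false
-- instance search on the nested operator spaces needs a deeper pending depth (as in `CoordCurvature.lean`)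
set_option maxSynthPendingDepth 3

noncomputable section

open scoped Manifold ContDiff Topology BigOperators ENNReal
open Filter Set Function TopologicalSpace MeasureTheory Metric Literature.Geometry.Lorentzian
open Literature.Geometry.Lorentzian.LandauLifshitz

namespace Summit.FinalStateConjecture.FinalStateConjecture.Theorems

namespace SublinearIsFree.ChargeModel

open SublinearIsFree.PseudotensorBound SublinearIsFree.QuasiStationarity LLBalance

/-- **The weighted decay clause, pointwise, in function form**: with
`F(t) = ⨆_{x ∈ U, x⁰ = t, ‖x~‖ ≤ κt} ⨆_{m ≤ 3} (1 + d^{7/4}) ‖D^m h(x)‖ₑ` and `εf = (min F 1).toReal`, at every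
time with `F(t) < 1` and every such point, `(1 + d^{7/4}) ‖D^m h(x)‖ ≤ εf(t)`. [folklore] -/
theorem weightedClause_pointwise_fn {N : ℕ} {U : Opens E4} {κ : ℝ} {ξ : Fin N → ℝ → E3}
    {h : E4 → E4 →L[ℝ] E4 →L[ℝ] ℝ} {t : ℝ}
    (ht : (⨆ x ∈ {x : U | x.1 0 = t ∧ E4.spatialNorm x.1 ≤ κ * t},
      ⨆ (m : ℕ) (_ : m ≤ 3), ENNReal.ofReal (1 + √(√((⨅ i, ‖E4.spatial x.1 - ξ i t‖) ^ 7))) *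
        ‖iteratedFDeriv ℝ m h x.1‖ₑ) < 1)
    {x : E4} (hxU : x ∈ (U : Set E4)) (hx0 : x 0 = t) (hxκ : E4.spatialNorm x ≤ κ * t) {m : ℕ} (hm : m ≤ 3) :
    (1 + √(√((⨅ i, ‖E4.spatial x - ξ i t‖) ^ 7))) * ‖iteratedFDeriv ℝ m h x‖ ≤
      (min (⨆ x ∈ {x : U | x.1 0 = t ∧ E4.spatialNorm x.1 ≤ κ * t},
        ⨆ (m : ℕ) (_ : m ≤ 3), ENNReal.ofReal (1 + √(√((⨅ i, ‖E4.spatial x.1 - ξ i t‖) ^ 7))) *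
          ‖iteratedFDeriv ℝ m h x.1‖ₑ) 1).toReal := by
  refine WindowBounds.mul_norm_le_of_le_ofReal (a := iteratedFDeriv ℝ m h x) (by positivity)
    ENNReal.toReal_nonneg ?_
  rw [← eq_ofReal_toReal_min_one ht]
  exact le_iSup₂_of_le (⟨x, hxU⟩ : U) ⟨hx0, hxκ⟩ (le_iSup₂_of_le m hm le_rfl)

/-- The pairwise separation `Dm(t) = min_{(i,j)} (‖ξ_i(t) − ξ_j(t)‖ + [i = j](max t 1)²)`: a lower
bound for every `‖ξ_i(t) − ξ_j(t)‖`, `i ≠ j`, tending to infinity when all pairwise distances do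
(`N ≥ 1`). [folklore] -/
theorem pairSep_props {N : ℕ} (hN : 0 < N) (ξ : Fin N → ℝ → E3)
    (hsep : ∀ i j, i ≠ j → Tendsto (fun t ↦ ‖ξ i t - ξ j t‖) atTop atTop) :
    (∀ t i j, i ≠ j → (⨅ p : Fin N × Fin N, (‖ξ p.1 t - ξ p.2 t‖ + if p.1 = p.2 then (max t 1) ^ 2 else 0)) ≤
        ‖ξ i t - ξ j t‖) ∧
    Tendsto (fun t ↦ ⨅ p : Fin N × Fin N, (‖ξ p.1 t - ξ p.2 t‖ + if p.1 = p.2 then (max t 1) ^ 2 else 0))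
      atTop atTop := by
  haveI : Nonempty (Fin N × Fin N) := ⟨(⟨0, hN⟩, ⟨0, hN⟩)⟩
  refine ⟨fun t i j hij ↦ ?_, ?_⟩
  · have h := ciInf_le (Set.finite_range fun p : Fin N × Fin N ↦
      (‖ξ p.1 t - ξ p.2 t‖ + if p.1 = p.2 then (max t 1) ^ 2 else 0)).bddBelow (i, j)
    simpa only [hij, if_false, add_zero] using h
  · rw [Filter.tendsto_atTop]
    intro b
    have hsq : Tendsto (fun t : ℝ ↦ (max t 1) ^ 2) atTop atTop := by
      refine tendsto_atTop_mono (fun t ↦ ?_) tendsto_id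
      have h1 : 1 ≤ max t 1 := le_max_right _ _
      have h2 : t ≤ max t 1 := le_max_left _ _
      show t ≤ (max t 1) ^ 2
      nlinarith
    have hall : ∀ᶠ t in atTop, ∀ p : Fin N × Fin N,
        b ≤ ‖ξ p.1 t - ξ p.2 t‖ + if p.1 = p.2 then (max t 1) ^ 2 else 0 := by
      refine eventually_all.2 fun p ↦ ?_
      by_cases hp : p.1 = p.2
      · filter_upwards [Filter.tendsto_atTop.1 hsq b] with t ht
        rw [if_pos hp]
        linarith [norm_nonneg (ξ p.1 t - ξ p.2 t)]
      · filter_upwards [Filter.tendsto_atTop.1 (hsep _ _ hp) b] with t ht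
        rw [if_neg hp, add_zero]
        exact ht
    filter_upwards [hall] with t ht
    exact le_ciInf fun p ↦ ht p

/-- `((d^{7/4})⁻¹)² = d^{-7/2}` for `d > 0`. [folklore] -/
theorem inv_rpow_seven_fourths_sq {d : ℝ} (hd : 0 < d) : ((d ^ (7 / 4 : ℝ))⁻¹) ^ 2 = d ^ (-(7 / 2) : ℝ) := by
  rw [inv_pow, ← Real.rpow_natCast (d ^ (7 / 4 : ℝ)) 2, ← Real.rpow_mul hd.le, Real.rpow_neg hd.le]
  norm_num

/-- Points of a window ball lie in the cone `‖y‖ ≤ κ t`: `dist y c ≤ R`, `‖c‖ + R ≤ (κ + κ²)/2 · t`,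
`0 ≤ κ ≤ 1`, `0 ≤ t`. [folklore] -/
theorem norm_le_cone_of_window {y c : E3} {R κ t : ℝ} (hy : dist y c ≤ R) (hcR : ‖c‖ + R ≤ (κ + κ ^ 2) / 2 * t)
    (hκ0 : 0 ≤ κ) (hκ1 : κ ≤ 1) (ht : 0 ≤ t) : ‖y‖ ≤ κ * t := by
  have h1 : ‖y‖ ≤ ‖c‖ + R := by
    have := norm_le_norm_add_norm_sub' y c
    rw [dist_eq_norm] at hy
    linarith [norm_sub_rev y c]
  have h2 : (κ + κ ^ 2) / 2 * t ≤ κ * t := by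
    have : κ ^ 2 ≤ κ := by nlinarith
    nlinarith
  linarith

/-- Monotonicity of the defect bound in the distance, the rates and the mass. [folklore] -/
theorem defectBound_mono {M Mm G B₀ B₁ r r' w w' d ρ₀ : ℝ} (hM : |M| ≤ Mm) (hG : 0 ≤ G) (hB₀ : 0 ≤ B₀)
    (hB₁ : 0 ≤ B₁) (hr : 0 ≤ r) (hrr' : r ≤ r') (hw : 0 ≤ w) (hww' : w ≤ w') (hρ₀ : 0 < ρ₀) (hd : ρ₀ ≤ d) :
    |M| * G ^ 2 * ((B₁ * G + 2 * B₀) * (4 * G * r) / d + B₁ * G * w / d ^ 2) ≤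
      Mm * G ^ 2 * ((B₁ * G + 2 * B₀) * (4 * G) * (r' * ρ₀) / ρ₀ ^ 2 + B₁ * G * w' / ρ₀ ^ 2) := by
  have hd0 : 0 < d := hρ₀.trans_le hd
  have hr' : 0 ≤ r' := hr.trans hrr'
  have hw' : 0 ≤ w' := hw.trans hww'
  have h1 : (B₁ * G + 2 * B₀) * (4 * G * r) / d ≤ (B₁ * G + 2 * B₀) * (4 * G) * (r' * ρ₀) / ρ₀ ^ 2 := by
    rw [show (B₁ * G + 2 * B₀) * (4 * G) * (r' * ρ₀) / ρ₀ ^ 2 = (B₁ * G + 2 * B₀) * (4 * G * r') / ρ₀ by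
      field_simp]
    exact div_le_div₀ (by positivity) (by nlinarith [mul_nonneg (by positivity : 0 ≤ (B₁ * G + 2 * B₀) * (4 * G)) (sub_nonneg.2 hrr')]) hρ₀ hd
  have h2 : B₁ * G * w / d ^ 2 ≤ B₁ * G * w' / ρ₀ ^ 2 :=
    div_le_div₀ (by positivity) (mul_le_mul_of_nonneg_left hww' (by positivity)) (by positivity)
      (pow_le_pow_left₀ hρ₀.le hd 2)
  have h3 : 0 ≤ (B₁ * G + 2 * B₀) * (4 * G * r) / d + B₁ * G * w / d ^ 2 := by positivity
  calc |M| * G ^ 2 * ((B₁ * G + 2 * B₀) * (4 * G * r) / d + B₁ * G * w / d ^ 2)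
      ≤ Mm * G ^ 2 * ((B₁ * G + 2 * B₀) * (4 * G * r) / d + B₁ * G * w / d ^ 2) :=
        mul_le_mul_of_nonneg_right (mul_le_mul_of_nonneg_right hM (sq_nonneg _)) h3
    _ ≤ Mm * G ^ 2 * ((B₁ * G + 2 * B₀) * (4 * G) * (r' * ρ₀) / ρ₀ ^ 2 + B₁ * G * w' / ρ₀ ^ 2) :=
        mul_le_mul_of_nonneg_left (add_le_add h1 h2) (mul_nonneg ((abs_nonneg M).trans hM) (sq_nonneg _))

/-- **The momentum density of a frozen boosted Kerr field is continuous on every lab sphere of radius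
`> |a|` about its centre** (smoothness of `h` on the boosted chart domain). [cite: KerrSchild1965, §3] -/
theorem continuousOn_hField_frozen_sphere (Λ : lorentzGroup) (ξ₀ : E3) (M a t : ℝ) {ρ₀ : ℝ} (hρ₀ : |a| < ρ₀)
    (μ : Fin 4) (k : Fin 3) :
    ContinuousOn (fun y ↦ hField (boostedKerrBilin Λ (E4.ofTimeSpace t ξ₀) M a) (E4.ofTimeSpace t y) μ 0 k.succ)
      (sphere ξ₀ ρ₀) := by
  set V : Set E4 := poincareInv Λ (E4.ofTimeSpace t ξ₀) ⁻¹' (Kerr.region a 0 : Set E4) with hV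
  have hVo : IsOpen V := KSFlux.isOpen_preimage_region Λ _ a 0
  have hg : ContDiffOn ℝ ∞ (boostedKerrBilin Λ (E4.ofTimeSpace t ξ₀) M a) V := fun x hx ↦
    (contDiffAt_boostedKerrBilin Λ _ M a (Kerr.radius_pos_of_mem_region hx)).contDiffWithinAt
  have hdet : ∀ x ∈ V, metricDet (boostedKerrBilin Λ (E4.ofTimeSpace t ξ₀) M a) x ≠ 0 := fun x hx ↦ by
    obtain ⟨φ, ℓ, n, hn, hℓ, hK⟩ := KSFlux.boostedKerr_nullRankOne Λ (E4.ofTimeSpace t ξ₀) a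
      (Kerr.radius_pos_of_mem_region hx)
    rw [KSFlux.boostedKerrBilin_eq_ksFamily Λ _ M a,
      KSFlux.metricDet_ksFamily (K := fun z ↦ boostedKerrBilin Λ (E4.ofTimeSpace t ξ₀) 1 a z - Minkowski.bilin)
        hn hℓ hK M]
    norm_num
  have hH := (contDiffOn_hField hVo hg hdet μ 0 k.succ).continuousOn
  refine (hH.comp (E4.continuous_ofTimeSpace t).continuousOn fun y hy ↦ ?_)
  show poincareInv Λ (E4.ofTimeSpace t ξ₀) (E4.ofTimeSpace t y) ∈ (Kerr.region a 0 : Set E4)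
  rw [SetLike.mem_coe, Kerr.mem_region, max_self]
  refine Kerr.radius_pos_of_abs_lt (hρ₀.trans_le ?_)
  have h := KSDecay.norm_sub_le_spatialNorm_poincareInv Λ ξ₀ (E4.ofTimeSpace t y)
  rw [E4.ofTimeSpace_apply_zero, E4.spatial_ofTimeSpace] at h
  rw [mem_sphere, dist_eq_norm] at hy
  rwa [hy] at h


/-- Registered sub-goal form (stub `ll_inv_rpow_seven_fourths_sq` of the crux item) of `inv_rpow_seven_fourths_sq`:
`((d^{7/4})⁻¹)² = d^{-7/2}`. [folklore] -/
theorem _root_.Summit.FinalStateConjecture.FinalStateConjecture.Theorems.ll_inv_rpow_seven_fourths_sq : ∀ {d : ℝ}, 0 < d → ((d ^ (7 / 4 : ℝ))⁻¹) ^ 2 = d ^ (-(7 / 2) : ℝ) :=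
  fun hd ↦ inv_rpow_seven_fourths_sq hd

end SublinearIsFree.ChargeModel

end Summit.FinalStateConjecture.FinalStateConjecture.Theorems

end
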